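import Summits.KontsevichZagierPeriods.KontsevichZagierPeriods.Theorems.ValuedFieldSpecialisationCTConstructionCoreCalculus
import Summits.KontsevichZagierPeriods.KontsevichZagierPeriods.Theorems.ValuedFieldSpecialisationCTConstructionPermTyped
import Summits.KontsevichZagierPeriods.KontsevichZagierPeriods.Theorems.ValuedFieldSpecialisationCTConstructionThetaIterClosedForm
import Summits.KontsevichZagierPeriods.KontsevichZagierPeriods.Theorems.ValuedFieldSpecialisationCTConstructionLogPowCancellation
import Summits.KontsevichZagierPeriods.KontsevichZagierPeriods.Theorems.ValuedFieldSpecialisationParametricLiftingElementaryNetFibred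
import Summits.KontsevichZagierPeriods.KontsevichZagierPeriods.Theorems.HeckeMultiplicityOneTorsionFree

/-!
# Route ValuedFieldSpecialisation — crux `CTConstruction`: the pure-log step of the core reduction

Helper toward crux stmt-KontsevichZagierPeriods-3495 (`CTConstruction`), line `registered`, reshape r3 (the class core
from PURE + log2-cancellation). Two algebraic halves of the PURE-LOG STEP of the main induction
(`…CTConstructionCoreReduction.lean`), on the fixed universe of typed families `Rep i S` (`…CoreCalculus`):

* `logStep_extract`: from the relation `Σ_i (b*! · t i) • [V i] ∈ relations` delivered by the induction hypothesis
  (the `V i` being the special fibres of the all-`η` constant families, `[V i] ≡ [L_{B i}] * [r i]`,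
  `stub_etaBox_specialFibre`), torsion-freeness (`HeckeMultiplicityOne.mem_relations_of_zsmul_mem`), box splitting and box cancellation
  (`stub_logPowCancellation_of_logTwo`, from log2-CANCELLATION) give `Σ_i t i • [L_{B i − b*} × r i] ∈ relations`;
* `logStep_peel`: that coefficient relation makes the top log terms `Σ_{p i = 0, |Sᶜ| = b*} c i S • [Rep i S]` a FIBRED
  relation: each top typed family is sorted (`exists_sortPerm`, `stub_perm_typedElementary`) and recast
  (`exists_sorted_elementary`) into an elementary divergent product of type `(0, b*)` over `L_{B i − b*} × r i`, and the
  landed elementary-net lemma of item 3498 (`stub_elementaryNet_mem_fibredRelations`) applies to the single monomial group.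

Sources: M. Kontsevich, D. Zagier, *Periods* (2001), §1.2; the encoding is this route's. No definitions.
-/

noncomputable section

namespace Summit.KontsevichZagierPeriods.ValuedFieldSpecialisation

open MeasureTheory Set Filter
open scoped Topology
open Literature.NumberTheory.Transcendental Literature.NumberTheory.Transcendental.KZ
open Summit.KontsevichZagierPeriods.HeckeMultiplicityOne (mem_relations_of_zsmul_mem)

/-! ### The profile of an elimination state and the linearity of its class -/

section Profile

variable {k : ℕ} {p B : Fin k → ℕ}

/-- Membership in the profile `Λ c = {(p i, b) | c i S ≠ 0, b ≤ B i − |S|}` of a state. [folklore] -/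
theorem mem_profile_iff (c : (i : Fin k) → Finset (Fin (B i)) → ℤ) (q b : ℕ) :
    (q, b) ∈ ((Finset.univ.sigma fun i => Finset.univ.filter fun S : Finset (Fin (B i)) => c i S ≠ 0).biUnion
      fun x => (Finset.range (B x.1 - x.2.card + 1)).image fun b => (p x.1, b)) ↔
      ∃ x : Σ i, Finset (Fin (B i)), c x.1 x.2 ≠ 0 ∧ p x.1 = q ∧ b ≤ B x.1 - x.2.card := by
  simp only [Finset.mem_biUnion, Finset.mem_image, Finset.mem_range, Prod.mk.injEq, Finset.mem_sigma,
    Finset.mem_univ, Finset.mem_filter, true_and]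
  constructor
  · rintro ⟨x, hx, b', hb', hq, rfl⟩; exact ⟨x, hx, hq, Nat.lt_succ_iff.mp hb'⟩
  · rintro ⟨x, hx, hq, hb⟩; exact ⟨x, hx, b, Nat.lt_succ_iff.mpr hb, hq, rfl⟩

/-- **The profile strictly shrinks** when the new state is dominated by the old one (every new pair lies below an
old pair of the same generator) and one profile point is lost. [folklore] -/
theorem card_profile_lt (c c' : (i : Fin k) → Finset (Fin (B i)) → ℤ)
    (hdom : ∀ i U, c' i U ≠ 0 → ∃ S, S ⊆ U ∧ c i S ≠ 0)
    (hlost : ∃ q b, (q, b) ∈ ((Finset.univ.sigma fun i => Finset.univ.filter fun S : Finset (Fin (B i)) => c i S ≠ 0).biUnion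
        fun x => (Finset.range (B x.1 - x.2.card + 1)).image fun b => (p x.1, b)) ∧
      (q, b) ∉ ((Finset.univ.sigma fun i => Finset.univ.filter fun S : Finset (Fin (B i)) => c' i S ≠ 0).biUnion
        fun x => (Finset.range (B x.1 - x.2.card + 1)).image fun b => (p x.1, b))) :
    (((Finset.univ.sigma fun i => Finset.univ.filter fun S : Finset (Fin (B i)) => c' i S ≠ 0).biUnion
        fun x => (Finset.range (B x.1 - x.2.card + 1)).image fun b => (p x.1, b))).card <
      (((Finset.univ.sigma fun i => Finset.univ.filter fun S : Finset (Fin (B i)) => c i S ≠ 0).biUnion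
        fun x => (Finset.range (B x.1 - x.2.card + 1)).image fun b => (p x.1, b))).card := by
  obtain ⟨q, b, hqb, hqb'⟩ := hlost
  apply Finset.card_lt_card
  refine ⟨fun x hx => ?_, fun hsub => hqb' (hsub hqb)⟩
  obtain ⟨q', b'⟩ := x
  rw [mem_profile_iff] at hx ⊢
  obtain ⟨⟨i, U⟩, hU, hq, hb⟩ := hx
  obtain ⟨S, hSU, hS⟩ := hdom i U hU
  exact ⟨⟨i, S⟩, hS, hq, hb.trans (Nat.sub_le_sub_left (Finset.card_le_card hSU) _)⟩

end Profile

section Linearity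

variable {k : ℕ} {B d : Fin k → ℕ} {Rep : (i : Fin k) → Finset (Fin (B i)) → IntegralRep (B i + d i + 1 + 1)}

/-- The class of a state is additive: differences. [folklore] -/
theorem D_sub (c c' : (i : Fin k) → Finset (Fin (B i)) → ℤ) :
    (∑ i, ∑ S : Finset (Fin (B i)), (c i S - c' i S) • of (Rep i S)) =
      (∑ i, ∑ S : Finset (Fin (B i)), c i S • of (Rep i S)) - ∑ i, ∑ S : Finset (Fin (B i)), c' i S • of (Rep i S) := by
  simp only [sub_smul, Finset.sum_sub_distrib]

/-- The class of a state is additive: finite sums. [folklore] -/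
theorem D_sum {ι : Type} (s : Finset ι) (f : ι → (i : Fin k) → Finset (Fin (B i)) → ℤ) :
    (∑ i, ∑ S : Finset (Fin (B i)), (∑ n ∈ s, f n i S) • of (Rep i S)) =
      ∑ n ∈ s, ∑ i, ∑ S : Finset (Fin (B i)), f n i S • of (Rep i S) := by
  simp only [Finset.sum_smul]
  rw [Finset.sum_comm]; refine Finset.sum_congr rfl fun i _ => ?_
  rw [Finset.sum_comm]

/-- The class of a state is additive: integer multiples. [folklore] -/
theorem D_mul (a : ℤ) (c : (i : Fin k) → Finset (Fin (B i)) → ℤ) :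
    (∑ i, ∑ S : Finset (Fin (B i)), (a * c i S) • of (Rep i S)) = a • ∑ i, ∑ S : Finset (Fin (B i)), c i S • of (Rep i S) := by
  simp only [Finset.smul_sum, smul_smul]

end Linearity

/-! ### Evaluating `(Θ̂ − 1)^{b*}` on the log block -/

section LogBlock

variable {k : ℕ} {p B : Fin k → ℕ}

/-- Closed form of the iterated coefficient operator on a state (componentwise `thetaIter_apply`). [folklore] -/
theorem state_iterate_apply (c : (i : Fin k) → Finset (Fin (B i)) → ℤ) (n : ℕ) (i : Fin k) (U : Finset (Fin (B i))) :
    Nat.iterate (fun (c' : (i : Fin k) → Finset (Fin (B i)) → ℤ) => fun (i : Fin k) (U : Finset (Fin (B i))) => ((2 ^ p i : ℕ) * ∑ S ∈ U.powerset, c' i S : ℤ)) n c i U = ((2 ^ p i : ℕ) : ℤ) ^ n * ∑ S ∈ U.powerset, (n : ℤ) ^ (U \ S).card * c i S := by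
  have h1 := iterate_coeff_apply (fun i => ((2 ^ p i : ℕ) : ℤ)) n c i
  have h2 := thetaIter_apply (((2 ^ p i : ℕ) : ℤ)) (c i) n U
  have h3 : Nat.iterate (fun (c' : (i : Fin k) → Finset (Fin (B i)) → ℤ) => fun (i : Fin k) (U : Finset (Fin (B i))) => ((2 ^ p i : ℕ) * ∑ S ∈ U.powerset, c' i S : ℤ)) n c i = Nat.iterate (fun (f : Finset (Fin (B i)) → ℤ) =>
      fun (U : Finset (Fin (B i))) => ((2 ^ p i : ℕ) : ℤ) * ∑ S ∈ U.powerset, f S) n (c i) := h1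
  rw [h3]
  exact h2

/-- The state `(Θ̂ − 1)^{b*} c` is supported below the support of `c`. [folklore] -/
theorem logBlock_supp (c : (i : Fin k) → Finset (Fin (B i)) → ℤ) (bs : ℕ) (i : Fin k) (U : Finset (Fin (B i)))
    (hU : (∑ n ∈ Finset.range (bs + 1), ((-1 : ℤ) ^ (bs - n) * (bs.choose n : ℤ)) * Nat.iterate (fun (c' : (i : Fin k) → Finset (Fin (B i)) → ℤ) => fun (i : Fin k) (U : Finset (Fin (B i))) => ((2 ^ p i : ℕ) * ∑ S ∈ U.powerset, c' i S : ℤ)) n c i U) ≠ 0) : ∃ S, S ⊆ U ∧ c i S ≠ 0 := by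
  by_contra hcon
  push Not at hcon
  apply hU
  refine Finset.sum_eq_zero fun n _ => ?_
  rw [state_iterate_apply, Finset.sum_eq_zero (fun S hS => ?_)]
  · simp
  · rw [hcon S (Finset.mem_powerset.mp hS)]; simp

/-- **Evaluation on the log generators**: if every log pair of `c` has level `≤ b*`, then on a log generator `i`
(`p i = 0`) the state `(Θ̂ − 1)^{b*} c` equals `b*! · Σ_{S ⊆ U, |U ∖ S| = b*} c i S` (`altSum_thetaIter_eval`).
[folklore] -/
theorem logBlock_eval (c : (i : Fin k) → Finset (Fin (B i)) → ℤ) (bs : ℕ)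
    (hlvl : ∀ i S, c i S ≠ 0 → p i = 0 → B i - S.card ≤ bs) (i : Fin k) (U : Finset (Fin (B i))) (hpi : p i = 0) :
    (∑ n ∈ Finset.range (bs + 1), ((-1 : ℤ) ^ (bs - n) * (bs.choose n : ℤ)) * Nat.iterate (fun (c' : (i : Fin k) → Finset (Fin (B i)) → ℤ) => fun (i : Fin k) (U : Finset (Fin (B i))) => ((2 ^ p i : ℕ) * ∑ S ∈ U.powerset, c' i S : ℤ)) n c i U) = (bs.factorial : ℤ) * ∑ S ∈ U.powerset.filter (fun S => (U \ S).card = bs), c i S := by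
  have h : ∀ S, S ⊆ U → c i S ≠ 0 → (U \ S).card ≤ bs := by
    intro S hSU hS
    have h1 : (U \ S).card = U.card - S.card := Finset.card_sdiff_of_subset hSU
    have h2 : U.card ≤ B i := by simpa using Finset.card_le_univ U
    have h3 := hlvl i S hS hpi
    omega
  rw [← altSum_thetaIter_eval bs (c i) U h]
  refine Finset.sum_congr rfl fun n _ => ?_
  rw [state_iterate_apply, hpi]
  simp [mul_assoc]

/-- **Vanishing off the full shape**: under the same hypothesis, on a log generator the state `(Θ̂ − 1)^{b*} c`
vanishes at every `U ≠ univ`. [folklore] -/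
theorem logBlock_eval_zero (c : (i : Fin k) → Finset (Fin (B i)) → ℤ) (bs : ℕ)
    (hlvl : ∀ i S, c i S ≠ 0 → p i = 0 → B i - S.card ≤ bs) (i : Fin k) (U : Finset (Fin (B i))) (hpi : p i = 0)
    (hU : U ≠ Finset.univ) : (∑ n ∈ Finset.range (bs + 1), ((-1 : ℤ) ^ (bs - n) * (bs.choose n : ℤ)) * Nat.iterate (fun (c' : (i : Fin k) → Finset (Fin (B i)) → ℤ) => fun (i : Fin k) (U : Finset (Fin (B i))) => ((2 ^ p i : ℕ) * ∑ S ∈ U.powerset, c' i S : ℤ)) n c i U) = 0 := by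
  rw [logBlock_eval c bs hlvl i U hpi, Finset.sum_eq_zero (fun S hS => ?_), mul_zero]
  rw [Finset.mem_filter, Finset.mem_powerset] at hS
  by_contra hS0
  have h1 := hlvl i S hS0 hpi
  have h3 : (U \ S).card = U.card - S.card := Finset.card_sdiff_of_subset hS.1
  have h4 : U.card < B i := lt_of_le_of_ne (by simpa using Finset.card_le_univ U)
    (fun h => hU (Finset.eq_univ_of_card _ (by simpa using h)))
  have h5 := Finset.card_le_card hS.1
  have h6 := hS.2
  omega

end LogBlock

section Log

variable {Q : ℕ} (hQ : 0 < Q) {k : ℕ} {p B d : Fin k → ℕ} {r : (i : Fin k) → IntegralRep (d i)}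
  {Rep : (i : Fin k) → Finset (Fin (B i)) → IntegralRep (B i + d i + 1 + 1)}
  (hRd : ∀ (i : Fin k) (S : Finset (Fin (B i))), (Rep i S).domain = {z | ∃ (s u : ℝ) (t : Fin (B i) → ℝ) (w : Fin (d i) → ℝ), z = Matrix.vecCons s (Matrix.vecCons u (Fin.append t w)) ∧ 0 < s ∧ s < 1 ∧ 0 < u ∧ u ^ Q * s ^ p i < 1 ∧ (∀ j, ((if j ∈ S then (1 / 2 : ℚ) ^ Q else 1 : ℚ) : ℝ) * s ^ (if j ∈ S then 0 else 1) ≤ t j ∧ t j ≤ 1) ∧ w ∈ (r i).domain})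
  (hRi : ∀ (i : Fin k) (S : Finset (Fin (B i))), (Rep i S).integrand = (fun z => (∏ j : Fin (B i), (z (Fin.castAdd (d i) j).succ.succ)⁻¹) * (r i).integrand (fun l : Fin (d i) => z (Fin.natAdd (B i) l).succ.succ)))
  {bs : ℕ} (hbs : 0 < bs) {L : (m : ℕ) → IntegralRep m}
  (hLd : ∀ m, (L m).domain = {t | ∀ j, (((1 / 2 : ℚ) ^ Q : ℚ) : ℝ) ≤ t j ∧ t j ≤ 1})
  (hLi : ∀ m, (L m).integrand = fun t => ∏ j, (t j)⁻¹)

include hQ hRd hRi hbs hLd hLi in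
/-- **Peeling the top log terms.** If the box-coefficient class
`Σ_{p i = 0, b* ≤ B i} (Σ_{|Sᶜ| = b*} c i S) • [L_{B i − b*} × r i]` is a relation, then the top log terms
`Σ_{p i = 0, |Sᶜ| = b*} c i S • [Rep i S]` form a fibred relation. [folklore] -/
theorem logStep_peel (c : (i : Fin k) → Finset (Fin (B i)) → ℤ)
    (hX : (∑ i, if p i = 0 ∧ bs ≤ B i then
      (∑ S ∈ (Finset.univ : Finset (Fin (B i))).powerset.filter (fun S => (Finset.univ \ S).card = bs), c i S) •
        of ((L (B i - bs)).prod (r i)) else 0) ∈ relations) :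
    (∑ i, ∑ S : Finset (Fin (B i)), (if p i = 0 ∧ (Finset.univ \ S).card = bs then c i S else 0) • of (Rep i S)) ∈
      fibredRelations := by
  classical
  -- the top pairs
  let TopP : (Σ i, Finset (Fin (B i))) → Prop := fun x => p x.1 = 0 ∧ bs ≤ B x.1 ∧ (Finset.univ \ x.2).card = bs
  -- each top typed family is fibred-equivalent to an elementary product of type `(0, b*)` over `L_{B i − b*} × r i`
  have hP : ∀ x : Σ i, Finset (Fin (B i)), TopP x → ∃ P : IntegralRep (bs + (B x.1 - bs + d x.1) + 1 + 1),
      P.domain = {z | ∃ (s u : ℝ) (y : Fin bs → ℝ) (w : Fin (B x.1 - bs + d x.1) → ℝ), z = Matrix.vecCons s (Matrix.vecCons u (Fin.append y w)) ∧ 0 < s ∧ s < 1 ∧ 0 < u ∧ u ^ Q * s ^ (p x.1) < 1 ∧ (∀ j, s ≤ y j ∧ y j ≤ 1) ∧ w ∈ ((L (B x.1 - bs)).prod (r x.1)).domain} ∧ P.integrand = (fun z => (∏ j : Fin bs, (z (Fin.castAdd (B x.1 - bs + d x.1) j).succ.succ)⁻¹) * ((L (B x.1 - bs)).prod (r x.1)).integrand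 (fun l : Fin (B x.1 - bs + d x.1) => z (Fin.natAdd bs l).succ.succ)) ∧ of (Rep x.1 x.2) - of P ∈ fibredRelations := by
    rintro ⟨i, S⟩ ⟨hpi, hbi, hS⟩
    dsimp only at hpi hbi hS ⊢
    obtain ⟨σ, hσ⟩ := exists_sortPerm S hS
    obtain ⟨R', hR'd, hR'i, hR'⟩ := stub_perm_typedElementary Q (p i) (B i) (d i)
      (fun j => if j ∈ S then (1 / 2 : ℚ) ^ Q else 1) (fun j => if j ∈ S then 0 else 1) (r i) σ (Rep i S)
      (hRd i S) (hRi i S)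
    have hR'd' : R'.domain = {z | ∃ (s u : ℝ) (t : Fin (B i) → ℝ) (w : Fin (d i) → ℝ),
        z = Matrix.vecCons s (Matrix.vecCons u (Fin.append t w)) ∧ 0 < s ∧ s < 1 ∧ 0 < u ∧ u ^ Q * s ^ (p i) < 1 ∧
          (∀ j : Fin (B i), ((if (j : ℕ) < bs then 1 else (1 / 2 : ℚ) ^ Q : ℚ) : ℝ) * s ^ (if (j : ℕ) < bs then 1 else 0) ≤ t j ∧
            t j ≤ 1) ∧ w ∈ (r i).domain} := by
      rw [hR'd]
      ext z
      simp only [mem_setOf_eq, hσ, ite_not]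
    obtain ⟨P, hPd, hPi, hP⟩ := exists_sorted_elementary Q (p i) (B i) bs (B i - bs) (d i) (by omega)
      ((1 / 2 : ℚ) ^ Q) (half_pow_pos Q) (half_pow_le_one Q) (r i) (L (B i - bs)) (hLd _) (hLi _) R' hR'd' hR'i
    refine ⟨P, hPd, hPi, ?_⟩
    have := fibredRelations.add_mem hR' hP
    simpa using this
  choose P hPd hPi hPrel using hP
  -- enumerate the top pairs by `Fin K`
  let TopT := {x : Σ i, Finset (Fin (B i)) // TopP x}
  let e : Fin (Fintype.card TopT) ≃ TopT := (Fintype.equivFin TopT).symm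
  -- regrouping a sum over the top pairs
  have hregroup : ∀ (M : Type) [AddCommGroup M] (g : (Σ i, Finset (Fin (B i))) → M),
      (∑ κ, g (e κ).1) = ∑ i ∈ Finset.univ.filter (fun i => p i = 0 ∧ bs ≤ B i),
        ∑ S ∈ Finset.univ.filter (fun S : Finset (Fin (B i)) => (Finset.univ \ S).card = bs), g ⟨i, S⟩ := by
    intro M _ g
    rw [Equiv.sum_comp e (fun x : TopT => g x.1)]
    rw [← Finset.sum_subtype (Finset.univ.filter TopP) (by intro x; simp)]
    have hsig : (Finset.univ.filter TopP : Finset (Σ i, Finset (Fin (B i)))) =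
        (Finset.univ.filter (fun i => p i = 0 ∧ bs ≤ B i)).sigma
          (fun i => Finset.univ.filter (fun S : Finset (Fin (B i)) => (Finset.univ \ S).card = bs)) := by
      ext ⟨i, S⟩
      simp [TopP, and_assoc]
    rw [hsig, Finset.sum_sigma]
  -- the elementary net of the top terms is a fibred relation
  have hnet := stub_elementaryNet_mem_fibredRelations (Fintype.card TopT) (fun κ => c (e κ).1.1 (e κ).1.2)
    (fun κ => p (e κ).1.1) (fun _ => Q) (fun _ => bs) (fun κ => B (e κ).1.1 - bs + d (e κ).1.1)
    (fun κ => (L (B (e κ).1.1 - bs)).prod (r (e κ).1.1)) (fun κ => P (e κ).1 (e κ).2)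
    (fun κ => ⟨hQ, by rw [(e κ).2.1]; exact hQ, Or.inr hbs, hPd _ _, hPi _ _⟩) ?_
  swap
  · -- the single monomial group: its coefficient class is `hX`
    intro κ₀
    have hfilt : (Finset.univ.filter fun κ : Fin (Fintype.card TopT) =>
        ((p (e κ).1.1 : ℝ) / (Q : ℕ) : ℝ) = ((p (e κ₀).1.1 : ℝ) / (Q : ℕ) : ℝ) ∧ bs = bs) = Finset.univ := by
      ext κ
      simp [(e κ).2.1, (e κ₀).2.1]
    rw [hfilt, hregroup FormalRep (fun x => c x.1 x.2 • of ((L (B x.1 - bs)).prod (r x.1)))]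
    convert hX using 1
    rw [← Finset.sum_filter]
    refine Finset.sum_congr rfl fun i _ => ?_
    rw [Finset.sum_smul, Finset.powerset_univ]
  -- back from the net to the typed families
  have hdiff : (∑ κ, c (e κ).1.1 (e κ).1.2 • (of (Rep (e κ).1.1 (e κ).1.2) - of (P (e κ).1 (e κ).2))) ∈ fibredRelations :=
    fibredRelations.sum_mem fun κ _ => fibredRelations.zsmul_mem (hPrel _ _) _
  have hsum : (∑ κ, c (e κ).1.1 (e κ).1.2 • of (Rep (e κ).1.1 (e κ).1.2)) ∈ fibredRelations := by
    have := fibredRelations.add_mem hnet hdiff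
    convert this using 1
    rw [← Finset.sum_add_distrib]
    refine Finset.sum_congr rfl fun κ _ => ?_
    rw [smul_sub]; abel
  rw [hregroup FormalRep (fun x => c x.1 x.2 • of (Rep x.1 x.2))] at hsum
  dsimp only at hsum
  have hY : (∑ i ∈ Finset.univ.filter (fun i => ¬ (p i = 0 ∧ bs ≤ B i)),
      ∑ S : Finset (Fin (B i)), (if p i = 0 ∧ (Finset.univ \ S).card = bs then c i S else 0) • of (Rep i S)) = 0 := by
    refine Finset.sum_eq_zero fun i hi => Finset.sum_eq_zero fun S _ => ?_
    rw [Finset.mem_filter] at hi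
    have hi' := hi.2
    by_cases hpi : p i = 0
    · have hlt : B i < bs := by
        by_contra h; exact hi' ⟨hpi, not_lt.mp h⟩
      have hne : (Finset.univ \ S).card ≠ bs := by
        have : (Finset.univ \ S).card ≤ B i := by
          simpa using (Finset.card_le_univ (Finset.univ \ S))
        omega
      simp [hne]
    · simp [hpi]
  have hXeq : (∑ i ∈ Finset.univ.filter (fun i => p i = 0 ∧ bs ≤ B i),
      ∑ S : Finset (Fin (B i)), (if p i = 0 ∧ (Finset.univ \ S).card = bs then c i S else 0) • of (Rep i S)) =
      ∑ i ∈ Finset.univ.filter (fun i => p i = 0 ∧ bs ≤ B i),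
        ∑ S ∈ Finset.univ.filter (fun S : Finset (Fin (B i)) => (Finset.univ \ S).card = bs), c i S • of (Rep i S) := by
    refine Finset.sum_congr rfl fun i hi => ?_
    rw [Finset.mem_filter] at hi
    rw [Finset.sum_filter]
    refine Finset.sum_congr rfl fun S _ => ?_
    by_cases hS : (Finset.univ \ S).card = bs
    · simp [hi.2.1, hS]
    · simp [hS]
  rw [← Finset.sum_filter_add_sum_filter_not Finset.univ (fun i => p i = 0 ∧ bs ≤ B i), hY, add_zero, hXeq]
  exact hsum

include hQ hLd hLi in
/-- **Extracting the box coefficient.** From `Σ_i (b*! · t i) • [V i] ∈ relations` (the induction hypothesis of the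
log step), `[V i] ≡ [Lb i] * [r i]` with `Lb i` the box of dimension `B i`, torsion-freeness, box splitting
`[L_{B i}] * x ≡ [L_{b*}] * ([L_{B i − b*}] * x)` and box cancellation (from log2-cancellation):
`Σ_i t i • [L_{B i − b*} × r i] ∈ relations`. [folklore] -/
theorem logStep_extract (hL2C : ∀ (L : Literature.NumberTheory.Transcendental.KZ.IntegralRep 1), L.domain = {t | (1 / 2 : ℝ) ≤ t 0 ∧ t 0 ≤ 1} → L.integrand = (fun t => (t 0)⁻¹) → ∀ c : Literature.NumberTheory.Transcendental.KZ.FormalRep, Literature.NumberTheory.Transcendental.KZ.of L * c ∈ Literature.NumberTheory.Transcendental.KZ.relations → c ∈ Literature.NumberTheory.Transcendental.KZ.relations)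
    (t : Fin k → ℤ) (ht : ∀ i, t i ≠ 0 → p i = 0 ∧ bs ≤ B i)
    (V : (i : Fin k) → p i = 0 → IntegralRep (B i + d i + 1)) (Lb : (i : Fin k) → p i = 0 → IntegralRep (B i))
    (hLbd : ∀ i (h : p i = 0), (Lb i h).domain = {t | ∀ j, (((1 / 2 : ℚ) ^ Q : ℚ) : ℝ) ≤ t j ∧ t j ≤ 1})
    (hLbi : ∀ i (h : p i = 0), (Lb i h).integrand = fun t => ∏ j, (t j)⁻¹)
    (hVL : ∀ i (h : p i = 0), of (V i h) - of (Lb i h) * of (r i) ∈ relations)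
    (hy : (∑ i, if h : p i = 0 then ((bs.factorial : ℤ) * t i) • of (V i h) else 0) ∈ relations) :
    (∑ i, if p i = 0 ∧ bs ≤ B i then t i • of ((L (B i - bs)).prod (r i)) else 0) ∈ relations := by
  classical
  obtain ⟨-, hsplit, hcancel⟩ := stub_logPowCancellation_of_logTwo Q hQ
  -- torsion: divide by `b*!`
  have h1 : (∑ i, if h : p i = 0 then t i • of (V i h) else 0) ∈ relations := by
    refine mem_relations_of_zsmul_mem (a := (bs.factorial : ℤ)) (by exact_mod_cast bs.factorial_ne_zero) ?_
    rw [Finset.smul_sum]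
    convert hy using 1
    refine Finset.sum_congr rfl fun i _ => ?_
    split_ifs
    · rw [smul_smul]
    · simp
  -- replace the special fibres by the boxes
  have h2 : (∑ i, if h : p i = 0 then t i • (of (Lb i h) * of (r i)) else 0) ∈ relations := by
    have hd : (∑ i, if h : p i = 0 then t i • (of (V i h) - of (Lb i h) * of (r i)) else 0) ∈ relations :=
      relations.sum_mem fun i _ => by
        split_ifs with h
        · exact relations.zsmul_mem (hVL i h) _
        · exact relations.zero_mem
    have := relations.sub_mem h1 hd
    convert this using 1
    rw [← Finset.sum_sub_distrib]
    refine Finset.sum_congr rfl fun i _ => ?_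
    split_ifs
    · rw [smul_sub]; abel
    · simp
  -- drop the vanishing coefficients and split the boxes
  have h3 : (∑ i, if p i = 0 ∧ bs ≤ B i then t i • (of (L bs) * (of (L (B i - bs)) * of (r i))) else 0) ∈ relations := by
    have hd : (∑ i, ((if h : p i = 0 then t i • (of (Lb i h) * of (r i)) else 0) -
        (if p i = 0 ∧ bs ≤ B i then t i • (of (L bs) * (of (L (B i - bs)) * of (r i))) else 0))) ∈ relations := by
      refine relations.sum_mem fun i _ => ?_
      by_cases hpi : p i = 0
      · by_cases hbi : bs ≤ B i
        · rw [dif_pos hpi, if_pos ⟨hpi, hbi⟩, ← smul_sub]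
          exact relations.zsmul_mem (hsplit bs (B i - bs) (B i) (L bs) (L (B i - bs)) (Lb i hpi) (by omega)
            (hLd _) (hLi _) (hLd _) (hLi _) (hLbd i hpi) (hLbi i hpi) (of (r i))) _
        · have ht0 : t i = 0 := by by_contra h; exact hbi (ht i h).2
          simp [hpi, hbi, ht0]
      · simp [hpi]
    have := relations.sub_mem h2 hd
    convert this using 1
    rw [← Finset.sum_sub_distrib]
    refine Finset.sum_congr rfl fun i _ => ?_
    abel
  -- pull `[L_{b*}]` out and cancel it
  have h4 : of (L bs) * (∑ i, if p i = 0 ∧ bs ≤ B i then t i • (of (L (B i - bs)) * of (r i)) else 0) ∈ relations := by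
    convert h3 using 1
    rw [Finset.mul_sum]
    refine Finset.sum_congr rfl fun i _ => ?_
    split_ifs
    · exact (AddMonoidHom.mulLeft (of (L bs))).map_zsmul _ _
    · simp
  have h5 := hcancel hL2C bs (L bs) (hLd bs) (hLi bs) _ h4
  convert h5 using 1
  refine Finset.sum_congr rfl fun i _ => ?_
  split_ifs
  · rw [of_mul_of]
  · rfl

end Log

/-- **Registered stub `stub_logStep_peel`** (crux `CTConstruction`, line `registered`, reshape r3): explicit form of
`logStep_peel`. [folklore] -/
theorem stub_logStep_peel : ∀ (Q : ℕ), 0 < Q → ∀ (k : ℕ) (p B d : Fin k → ℕ) (r : (i : Fin k) → Literature.NumberTheory.Transcendental.KZ.IntegralRep (d i)) (Rep : (i : Fin k) → Finset (Fin (B i)) → Literature.NumberTheory.Transcendental.KZ.IntegralRep (B i + d i + 1 + 1)), (∀ (i : Fin k) (S : Finset (Fin (B i))), (Rep i S).domain = {z | ∃ (s u : ℝ) (t : Fin (B i) → ℝ) (w : Fin (d i) → ℝ), z = Matrix.vecCons s (Matrix.vecCons u (Fin.append t w)) ∧ 0 < s ∧ s < 1 ∧ 0 < u ∧ u ^ Q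 * s ^ p i < 1 ∧ (∀ j, ((if j ∈ S then (1 / 2 : ℚ) ^ Q else 1 : ℚ) : ℝ) * s ^ (if j ∈ S then 0 else 1) ≤ t j ∧ t j ≤ 1) ∧ w ∈ (r i).domain}) → (∀ (i : Fin k) (S : Finset (Fin (B i))), (Rep i S).integrand = (fun z => (∏ j : Fin (B i), (z (Fin.castAdd (d i) j).succ.succ)⁻¹) * (r i).integrand (fun l : Fin (d i) => z (Fin.natAdd (B i) l).succ.succ))) → ∀ (bs : ℕ), 0 < bs → ∀ (L : (m : ℕ) → Literature.NumberTheory.Transcendental.KZ.IntegralRep m), (∀ m, (L m).domain = {t | ∀ j, (((1 / 2 : ℚ) ^ Q : ℚ) : ℝ) ≤ t j ∧ t j ≤ 1}) → (∀ m, (L m).integrand = fun t => ∏ j, (t j)⁻¹) → ∀ (c : (i : Fin k) → Finset (Fin (B i)) → ℤ), (∑ i, if p i = 0 ∧ bs ≤ B i then (∑ S ∈ (Finset.univ : Finset (Fin (B i))).powerset.filter (fun S => (Finset.univ \ S).card = bs), c i S) • Literature.NumberTheory.Transcendental.KZ.of ((L (B i - bs)).prod (r i)) else 0) ∈ Literature.NumberTheory.Transcendental.KZ.relations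 → (∑ i, ∑ S : Finset (Fin (B i)), (if p i = 0 ∧ (Finset.univ \ S).card = bs then c i S else 0) • Literature.NumberTheory.Transcendental.KZ.of (Rep i S)) ∈ Literature.NumberTheory.Transcendental.KZ.fibredRelations := by
  intro Q hQ k p B d r Rep hRd hRi bs hbs L hLd hLi c hX
  exact logStep_peel hQ hRd hRi hbs hLd hLi c hX

end Summit.KontsevichZagierPeriods.ValuedFieldSpecialisation
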